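import Summits.QuantumFields.YangMills.Theorems.SusceptibilityToPoincare.Negative.HoldFalseOfTwistSectorInputs
import HarnessLib

/-!
# `SusceptibilityToPoincare` — negative lemma modulo `TwistSectorInputs`, re-filed for the item HOLD (lead c13)

Crux `stmt-QuantumFields-9441` (`Summit.QuantumFields.YangMills.Theses.FradkinShenkerFlow.SusceptibilityToPoincare`).
The typed decl is `CoreSC ∧ T` (`Restatement.crux_iff_coreSC_and_residual`, p127070) and `T` is refuted modulo
`Literature.MathematicalPhysics.QuantumFieldTheory.TwistSectorInputs` (p76563, p142942) and modulo the weaker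
`Negative.FiniteSusceptibilityMetastableFamily` (p141393).  This file only re-exports the standing conditional
refutation in the exact `H → ¬ Decl` shape under a fresh name, so that it can be filed with the hold flag from a
seat/flag combination the gate honours (p76563's flag was consumed by the relocation rewrite; p141393/p142942 were
recorded as plain supports).  Nothing here asserts a Theses statement or the open bundle.
-/

noncomputable section

namespace Summit.QuantumFields.YangMills.Theorems.SusceptibilityToPoincare.Negative.HoldC13

open Literature.MathematicalPhysics.QuantumFieldTheory

/-- **`¬ SusceptibilityToPoincare` modulo `TwistSectorInputs`** (hold form, lead c13): an inhabitant of 't Hooft's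
twist-sector input bundle (`TwistSectorInputs`: some admissible centreless `G`, `r`, `β ≥ 0` with finite gauge-invariant
susceptibility and a window family of gauge-invariant events with vanishing single-link heat-bath flux) refutes the crux
AS TYPED; derived from `Negative.Hold.SusceptibilityToPoincare_false_of_TwistSectorInputs` (window bundle ⇒ metastable
bundle ⇒ bottleneck).  Class when inhabited: refuted-misstated, repair C″ = `SusceptibilityToPoincareSC`. [folklore] -/
theorem SusceptibilityToPoincare_false_of_TwistSectorInputs :
    TwistSectorInputs → ¬ Summit.QuantumFields.YangMills.Theses.FradkinShenkerFlow.SusceptibilityToPoincare :=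
  fun h => Hold.SusceptibilityToPoincare_false_of_TwistSectorInputs h

end Summit.QuantumFields.YangMills.Theorems.SusceptibilityToPoincare.Negative.HoldC13
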